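import Mathlib
import Summits.Ventures.PercRepro2.TypedResidualCrux
import Summits.Ventures.PercRepro2.TypedResidualMarks
import Summits.Ventures.PercRepro2.TypedCoincidence

/-!
# The crux assembly with the mark coincidences removed (blind cell PercRepro2, p2 g0, 2026-08-25;
sub-claim S1, `proofs/subclaims/S1-REDUCTION.md`)

`TypedResidualCrux.lean` gives the crux of record from `ResidualCon_all R`. Here the domain is
narrowed by the vanishing theorems of the cell: a typed base vanishes when a root coincides with
another mark (p1's `TypedVanishing.lean`, packaged as `RootsDistinct` in `TypedResidualMarks.lean`)
and when `o = a₃` (night-3's `TypedCoincidence.lean`).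

* **`HCov_all_of_residualConD_all`** — the crux from (TRI) on the root-connected residual instances
  whose roots are distinct from every other mark;
* **`HCov_all_of_residualConM_all`** — the same with, in addition, `o ≠ a₃`; the only coincidences
  left in the domain are `b = a₃` and `o = b`, which are live.

Own code; standard axioms.
-/

namespace Summit.Ventures.PercRepro2

open UnionCluster

namespace CovForm

namespace TypedRed

section CruxD

variable (R : Type*) [Field R] [LinearOrder R] [IsStrictOrderedRing R]

/-- The separated part with distinct roots, discharged by S2 likewise. -/
theorem residualSepD_all : ResidualSepD_all R := by
  intro V E _ _ _ _ ends o a₁ a₂ a₃ b F τ hτ hres _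
  exact Separated.typedCount_nonneg_of_typedConfig_sep ends o a₁ a₂ a₃ b F τ hτ hres.sep

/-- **The crux of record from (TRI) on the root-connected residual instances whose roots are
distinct from every other mark.** -/
theorem HCov_all_of_residualConD_all (hc : ResidualConD_all R) : HCov_all R :=
  HCov_all_of_sep_con_rootsDistinct R (residualSepD_all R) hc

end CruxD

section MarksDistinct

variable {V : Type*} {E : Type*} [DecidableEq V] [Fintype E] [DecidableEq E]

/-- The roots distinct from every other mark, and `o ≠ a₃`: the only coincidences left are
`b = a₃` and `o = b` (the live ones). -/
def MarksDistinct (o a₁ a₂ a₃ b : V) : Prop := RootsDistinct o a₁ a₂ a₃ b ∧ o ≠ a₃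

variable {R : Type*} [Field R] [LinearOrder R] [IsStrictOrderedRing R]

omit [DecidableEq V] in
/-- A coincidence with a root, or `o = a₃`, kills every typed base. -/
theorem typedCount_eq_zero_of_not_marksDistinct (ends : E → Sym2 V) {o a₁ a₂ a₃ b : V}
    (h : ¬ MarksDistinct o a₁ a₂ a₃ b) (F : Finset E) (z : Config E) (τ : E → ℕ) :
    typedCount F z τ (K3 ends o a₁ a₂ a₃ b : Config E → Config E → Config E → R) = 0 := by
  by_cases hr : RootsDistinct o a₁ a₂ a₃ b
  · have ho : o = a₃ := by
      by_contra hne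
      exact h ⟨hr, hne⟩
    subst ho
    exact TypedA3.typedCount_eq_zero_of_o_eq_a3 ends a₁ a₂ o b F z τ
  · exact typedCount_eq_zero_of_not_rootsDistinct ends hr F z τ

end MarksDistinct

section CruxM

variable (R : Type*) [Field R] [LinearOrder R] [IsStrictOrderedRing R]

/-- **Row 2′TRI on the root-connected residual instances with all marks distinct except possibly
`b = a₃` / `o = b`** — the sharpest form of sub-claim S4's domain. -/
def ResidualConM_all : Prop :=
  ∀ (V E : Type) [Fintype V] [DecidableEq V] [Fintype E] [DecidableEq E]
    (ends : E → Sym2 V) (o a₁ a₂ a₃ b : V) (F : Finset E) (τ : E → ℕ),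
    (∀ e ∈ F, τ e = 1 ∨ τ e = 2) → ResidualCon ends o a₁ a₂ a₃ b F →
      MarksDistinct o a₁ a₂ a₃ b →
      0 ≤ typedCount F (fun _ => false) τ
        (K3 ends o a₁ a₂ a₃ b : Config E → Config E → Config E → R)

/-- **The crux of record from (TRI) on the root-connected residual instances with distinct
marks** (`b = a₃`, `o = b` excepted). -/
theorem HCov_all_of_residualConM_all (hc : ResidualConM_all R) : HCov_all R := by
  refine HCov_all_of_residualCon_all R ?_
  intro V E _ _ _ _ ends o a₁ a₂ a₃ b F τ hτ hres
  by_cases hm : MarksDistinct o a₁ a₂ a₃ b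
  · exact hc V E ends o a₁ a₂ a₃ b F τ hτ hres hm
  · rw [typedCount_eq_zero_of_not_marksDistinct ends hm]

end CruxM

end TypedRed

end CovForm

end Summit.Ventures.PercRepro2
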